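import Summits.AtomisticToContinuum.HydrodynamicLimit.Theorems.LambertianContactSwapLambertianEulerExpectedWindowProduction
import HarnessLib

/-!
# Jump-sum tools: measurability, integrability, additivity and truncation algebra of windowed
# collision sums along the Lambertian flow (tool `JumpSumTools` of line `Sketch`, crux stmt-AtomisticToContinuum-11854, lead c8)

Support file (`--supports stmt-AtomisticToContinuum-11854`).  Fixed-`N` measure theory of the WINDOWED JUMP SUM
of a summand `J : ℝ × Config → ℝ` over a time window `(a, b]` along the Lambertian hard-sphere recursion of
`Literature.MathematicalPhysics.KineticTheory.LambertianHardSphereFlow` (`z_m = lambertStateAfter`,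
`t_m = lambertInstant ∈ [0, ∞]`, `K_u = lambertCount`):
`Σ_{m < K_b} 1{a < t_{m+1}} J(t_{m+1}, z_m)` (written out literally in every statement; no definitions) —
the jump analogues of the landed time-integral window tools:

* `measurable_jumpSum` (T1): joint measurability in `(z, ξs)` for measurable `J` (hard spheres of diameter
  `hsDiameter σ N` on `𝕋³`, `0 < σ < 1/2`; `measurable_lambertCount/Instant/StateAfter` and
  `…ExpectedWindowProductionTools.measurable_sum_range_real`);
* `abs_jumpSum_le` / `integrable_jumpSum` (T2, main): for an energy-dominated summand `|J(t, w)| ≤ D (1 + E(w))`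
  the jump sum is dominated by `K_b · D (1 + E(z))` (energy is non-increasing along the recursion,
  `configEnergy_lambertStateAfter_le`), hence integrable under local Gibbs data ⊗ noise `λ_N ⊗ γ^ℕ` by the
  collision budget `…CollisionBudget.stub_collisionBudgetIntegrableLambda` fed with
  `…CollisionIntensity.stub_collisionIntensityLambda` (`(K_b + 1)(1 + E)` integrable);
* `indicatorCount_eq_sub` (T3, pathwise, off the Zeno set, any geometry): `Σ_{m<K_b} 1{a < t_{m+1}} = K_b − K_a`
  (`m < K_u ↔ t_{m+1} ≤ u` off the Zeno set, `…TimeLedgerStopping`);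
* `jumpSum_split` (T4, pathwise): additivity over `a ≤ c ≤ b` of the window;
* `abs_sub_trunc_sum_le` (T5, pure algebra): the two-level truncation error
  `|Σ 1{P} x − trunc_{ℓM}(Σ 1{P} trunc_ℓ x)| ≤ Σ 1{P} (|x| − ℓ)₊ + (ℓ (Σ 1{P} 1 − M))₊`.

No definitions, no named facts.  All [folklore] (bookkeeping of the relative-entropy method, H.-T. Yau,
Lett. Math. Phys. 22 (1991) §2).
-/

noncomputable section

namespace Summit.AtomisticToContinuum.HydrodynamicLimit.Theorems.LambertianContactSwapLambertianEulerJumpSumTools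

open scoped BigOperators Topology ENNReal
open MeasureTheory ProbabilityTheory Filter Set
open Literature.MathematicalPhysics.KineticTheory
open Literature.Analysis.FluidPDE Literature.Analysis.FluidPDE.Alexander
open Literature.Analysis.FunctionSpaces
open Summit.AtomisticToContinuum.HydrodynamicLimit.Theorems.LambertianContactSwapLambertianEulerExpectedWindowProductionTools
  (measurable_sum_range_real abs_sum_range_le_mul)
open Summit.AtomisticToContinuum.HydrodynamicLimit.Theorems.LambertianContactSwapLambertianEulerTimeLedgerStopping
  (instant_succ_le_of_lt_lambertCount ofReal_lt_instant_succ_iff lambertCount_mono_of_le sum_range_ite_sub_eq)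
open Summit.AtomisticToContinuum.HydrodynamicLimit.Theorems.LambertianContactSwapLambertianEulerCollisionBudget
  (collisionBudget_configEnergy_nonneg)

/-! ## T1. Measurability -/

/-- **T1. The windowed jump sum is jointly measurable in `(z, ξs)`** (hard spheres of diameter `hsDiameter σ N` on
`𝕋³`, `0 < σ < 1/2`, measurable summand `J`): each term `1{a < t_{m+1}} J(t_{m+1}, z_m)` is measurable
(`measurable_lambertInstant`, `measurable_lambertStateAfter`, `Measurable.ite`), and a sum over the measurable random
range `m < K_b` (`measurable_lambertCount`) of measurable terms is measurable (`measurable_sum_range_real`). [folklore] -/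
theorem measurable_jumpSum : ∀ {σ : ℝ}, 0 < σ → σ < 2⁻¹ → ∀ (N : ℕ) {J : ℝ × Config (N + 1) (Fin 3) T3 → ℝ},
    Measurable J → ∀ (a b : ℝ),
    Measurable (fun p : Config (N + 1) (Fin 3) T3 × (ℕ → V3) =>
      ∑ m ∈ Finset.range (lambertCount (Torus.geometry (Fin 3)) (hsDiameter σ N) p.2 p.1 b),
        if a < (lambertInstant (Torus.geometry (Fin 3)) (hsDiameter σ N) p.2 p.1 (m + 1)).toReal then
          J ((lambertInstant (Torus.geometry (Fin 3)) (hsDiameter σ N) p.2 p.1 (m + 1)).toReal,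
            lambertStateAfter (Torus.geometry (Fin 3)) (hsDiameter σ N) p.2 p.1 m) else 0) := by
  intro σ hσ hσ' N J hJ a b
  have hε' : hsDiameter σ N < 2⁻¹ := (hsDiameter_le hσ.le N).trans_lt hσ'
  have hG : (Torus.geometry (Fin 3)).IsHardSphereRegular (hsDiameter σ N) := Torus.isHardSphereRegular_geometry hε'
  have hGm : (Torus.geometry (Fin 3)).IsMeasurable := Torus.isMeasurable_geometry
  have hKm : Measurable fun p : Config (N + 1) (Fin 3) T3 × (ℕ → V3) =>
      lambertCount (Torus.geometry (Fin 3)) (hsDiameter σ N) p.2 p.1 b :=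
    measurable_lambertCount hG hGm b
  have hZm : ∀ m, Measurable fun p : Config (N + 1) (Fin 3) T3 × (ℕ → V3) =>
      lambertStateAfter (Torus.geometry (Fin 3)) (hsDiameter σ N) p.2 p.1 m :=
    fun m => measurable_lambertStateAfter hG hGm m
  have hTm : ∀ m : ℕ, Measurable fun p : Config (N + 1) (Fin 3) T3 × (ℕ → V3) =>
      (lambertInstant (Torus.geometry (Fin 3)) (hsDiameter σ N) p.2 p.1 (m + 1)).toReal := fun m =>
    (measurable_lambertInstant hG hGm (m + 1)).ennreal_toReal
  refine measurable_sum_range_real hKm fun m => ?_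
  exact Measurable.ite (measurableSet_lt measurable_const (hTm m)) (hJ.comp ((hTm m).prodMk (hZm m)))
    measurable_const

/-! ## T2. Domination and integrability -/

/-- **T2a. Energy domination of the windowed jump sum** (pathwise, every `(z, ξs)`): if
`|J(t, w)| ≤ D (1 + E(w))` with `D ≥ 0`, then `|Σ_{m<K_b} 1{a < t_{m+1}} J(t_{m+1}, z_m)| ≤ K_b · D (1 + E(z))`,
since the kinetic energy is non-increasing along the Lambertian recursion (`configEnergy_lambertStateAfter_le`)
and `|Σ_{m<K} f m| ≤ K · bound` (`abs_sum_range_le_mul`). [folklore] -/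
theorem abs_jumpSum_le : ∀ (σ : ℝ) (N : ℕ) (J : ℝ × Config (N + 1) (Fin 3) T3 → ℝ) {D : ℝ} (a b : ℝ),
    (∀ q, |J q| ≤ D * (1 + configEnergy q.2)) → 0 ≤ D →
    ∀ p : Config (N + 1) (Fin 3) T3 × (ℕ → V3),
      |∑ m ∈ Finset.range (lambertCount (Torus.geometry (Fin 3)) (hsDiameter σ N) p.2 p.1 b),
          (if a < (lambertInstant (Torus.geometry (Fin 3)) (hsDiameter σ N) p.2 p.1 (m + 1)).toReal then
            J ((lambertInstant (Torus.geometry (Fin 3)) (hsDiameter σ N) p.2 p.1 (m + 1)).toReal,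
              lambertStateAfter (Torus.geometry (Fin 3)) (hsDiameter σ N) p.2 p.1 m) else 0)| ≤
        (lambertCount (Torus.geometry (Fin 3)) (hsDiameter σ N) p.2 p.1 b : ℝ) * (D * (1 + configEnergy p.1)) := by
  intro σ N J D a b hJD hD p
  refine abs_sum_range_le_mul fun m => ?_
  split_ifs
  · refine (hJD _).trans (mul_le_mul_of_nonneg_left ?_ hD)
    dsimp only
    linarith [configEnergy_lambertStateAfter_le (G := Torus.geometry (Fin 3)) (ε := hsDiameter σ N) p.2 p.1 m]
  · rw [abs_zero]
    exact mul_nonneg hD (add_nonneg zero_le_one (collisionBudget_configEnergy_nonneg p.1))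

/-- **T2b (main). The windowed jump sum of an energy-dominated measurable summand is integrable under local Gibbs
data ⊗ noise.** For `0 < σ < 1/2`, continuous positive data profiles, every `N`, `Φ`, a measurable `J` with
`|J(t, w)| ≤ D (1 + E(w))`, `D ≥ 0`, and every window `(a, b]` with `b ≥ 0`, the sum
`Σ_{m<K_b} 1{a < t_{m+1}} J(t_{m+1}, z_m)` is `λ_N ⊗ γ^ℕ`-integrable: it is measurable (T1), dominated by
`K_b · D (1 + E)` (T2a), and `(K_b + 1)(1 + E)` is integrable by the collision budget
(`stub_collisionBudgetIntegrableLambda` fed with `stub_collisionIntensityLambda`); `Integrable.mono'`. [folklore] -/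
theorem integrable_jumpSum : ∀ {σ : ℝ}, 0 < σ → σ < 2⁻¹ → ∀ {a₀ θ₀ : T3 → ℝ} {u₀ : T3 → V3},
    Continuous a₀ → Continuous θ₀ → Continuous u₀ → (∀ x, 0 < a₀ x) → (∀ x, 0 < θ₀ x) →
    ∀ (N : ℕ) (Φ : HardSphereFlow (Torus.geometry (Fin 3)) (hsDiameter σ N) (N + 1))
      {J : ℝ × Config (N + 1) (Fin 3) T3 → ℝ}, Measurable J →
    ∀ {D : ℝ}, 0 ≤ D → (∀ q, |J q| ≤ D * (1 + configEnergy q.2)) → ∀ (a b : ℝ), 0 ≤ b →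
    Integrable (fun p : Config (N + 1) (Fin 3) T3 × (ℕ → V3) =>
      ∑ m ∈ Finset.range (lambertCount (Torus.geometry (Fin 3)) (hsDiameter σ N) p.2 p.1 b),
        if a < (lambertInstant (Torus.geometry (Fin 3)) (hsDiameter σ N) p.2 p.1 (m + 1)).toReal then
          J ((lambertInstant (Torus.geometry (Fin 3)) (hsDiameter σ N) p.2 p.1 (m + 1)).toReal,
            lambertStateAfter (Torus.geometry (Fin 3)) (hsDiameter σ N) p.2 p.1 m) else 0)
      ((localGibbsLaw σ a₀ u₀ θ₀ N Φ).prod (lambertNoise (Fin 3))) := by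
  intro σ hσ hσ' a₀ θ₀ u₀ ha₀ hθ₀ hu₀ ha₀0 hθ₀0 N Φ J hJ D hD hJD a b hb
  have hε' : hsDiameter σ N < 2⁻¹ := (hsDiameter_le hσ.le N).trans_lt hσ'
  have hG : (Torus.geometry (Fin 3)).IsHardSphereRegular (hsDiameter σ N) := Torus.isHardSphereRegular_geometry hε'
  have hGm : (Torus.geometry (Fin 3)).IsMeasurable := Torus.isMeasurable_geometry
  have hKm : Measurable fun p : Config (N + 1) (Fin 3) T3 × (ℕ → V3) =>
      lambertCount (Torus.geometry (Fin 3)) (hsDiameter σ N) p.2 p.1 b :=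
    measurable_lambertCount hG hGm b
  have hE0 : ∀ w : Config (N + 1) (Fin 3) T3, 0 ≤ 1 + configEnergy w := fun w =>
    add_nonneg zero_le_one (collisionBudget_configEnergy_nonneg w)
  -- the collision budget `(K_b + 1)(1 + E)` is integrable
  have hInt : Integrable (fun q : Config (N + 1) (Fin 3) T3 × (ℕ → V3) =>
      ((lambertCount (Torus.geometry (Fin 3)) (hsDiameter σ N) q.2 q.1 b : ℝ) + 1) * (1 + configEnergy q.1))
      ((localGibbsLaw σ a₀ u₀ θ₀ N Φ).prod (lambertNoise (Fin 3))) :=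
    LambertianContactSwapLambertianEulerCollisionBudget.stub_collisionBudgetIntegrableLambda
      LambertianContactSwapLambertianEulerCollisionIntensity.stub_collisionIntensityLambda hσ hσ' ha₀ hθ₀ hu₀ ha₀0 hθ₀0
      N Φ b hb
  -- the dominating function `K_b · D (1 + E)`
  have hDint : Integrable (fun p : Config (N + 1) (Fin 3) T3 × (ℕ → V3) =>
      (lambertCount (Torus.geometry (Fin 3)) (hsDiameter σ N) p.2 p.1 b : ℝ) * (D * (1 + configEnergy p.1)))
      ((localGibbsLaw σ a₀ u₀ θ₀ N Φ).prod (lambertNoise (Fin 3))) := by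
    refine (hInt.const_mul D).mono' ?_ (Eventually.of_forall fun p => ?_)
    · exact ((measurable_from_nat (f := fun n : ℕ => (n : ℝ)) |>.comp hKm).mul (measurable_const.mul
        (measurable_const.add (measurable_configEnergy.comp measurable_fst)))).aestronglyMeasurable
    · rw [Real.norm_of_nonneg (mul_nonneg (Nat.cast_nonneg _) (mul_nonneg hD (hE0 p.1)))]
      have hK0 : (0 : ℝ) ≤ (lambertCount (Torus.geometry (Fin 3)) (hsDiameter σ N) p.2 p.1 b : ℝ) := Nat.cast_nonneg _
      nlinarith [mul_nonneg hD (hE0 p.1), hK0]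
  exact hDint.mono' (measurable_jumpSum hσ hσ' N hJ a b).aestronglyMeasurable (Eventually.of_forall fun p =>
    (Real.norm_eq_abs _).trans_le (abs_jumpSum_le σ N J a b hJD hD p))

/-! ## T3/T4. Pathwise bookkeeping off the Zeno set -/

section Pathwise

variable {d : Type*} [Fintype d] {X : Type*} {N : ℕ} {G : Geometry d X} {ε : ℝ}
  {ξs : ℕ → EuclideanSpace ℝ d} {z : Config N d X}

/-- Off the Zeno set at `b`, for a counted collision `m < K_b` and `0 ≤ u ≤ b`:
`u < (t_{m+1}).toReal ↔ K_u ≤ m` (the instant is finite, `ofReal_lt_instant_succ_iff`). [folklore] -/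
theorem lt_toReal_instant_succ_iff_of_lt_count {u b : ℝ} {m : ℕ} (hu : 0 ≤ u) (hub : u ≤ b)
    (hex : ∃ k, ENNReal.ofReal b < lambertInstant G ε ξs z k) (hm : m < lambertCount G ε ξs z b) :
    u < (lambertInstant G ε ξs z (m + 1)).toReal ↔ lambertCount G ε ξs z u ≤ m := by
  have hfin : lambertInstant G ε ξs z (m + 1) ≠ ∞ :=
    ne_top_of_le_ne_top ENNReal.ofReal_ne_top (instant_succ_le_of_lt_lambertCount hex hm)
  have hexu : ∃ k, ENNReal.ofReal u < lambertInstant G ε ξs z k :=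
    hex.imp fun k hk => (ENNReal.ofReal_le_ofReal hub).trans_lt hk
  rw [← ENNReal.ofReal_lt_iff_lt_toReal hu hfin, ofReal_lt_instant_succ_iff hexu]

/-- **T3. The number of window contacts**: off the Zeno set at `b` (some instant passes beyond `b`), for
`0 ≤ a ≤ b`, `Σ_{m<K_b} 1{a < t_{m+1}} = K_b − K_a`. For `m < K_b` the instant `t_{m+1} ≤ b` is finite and
`a < t_{m+1} ↔ K_a ≤ m` (`ofReal_lt_instant_succ_iff`), `K_a ≤ K_b` (`lambertCount_mono_of_le`), and
`Σ_{m<K_b} 1{K_a ≤ m} = K_b − K_a` (telescoping, `sum_range_ite_sub_eq`). [folklore] -/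
theorem indicatorCount_eq_sub : ∀ {d : Type*} [Fintype d] {X : Type*} {N : ℕ} {G : Geometry d X} {ε : ℝ}
    {ξs : ℕ → EuclideanSpace ℝ d} {z : Config N d X} {a b : ℝ}, 0 ≤ a → a ≤ b →
    (∃ k, ENNReal.ofReal b < lambertInstant G ε ξs z k) →
    (∑ m ∈ Finset.range (lambertCount G ε ξs z b),
        if a < (lambertInstant G ε ξs z (m + 1)).toReal then (1 : ℝ) else 0) =
      (lambertCount G ε ξs z b : ℝ) - (lambertCount G ε ξs z a : ℝ) := by
  intro d _ X N G ε ξs z a b ha hab hex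
  rw [← sum_range_ite_sub_eq (fun m : ℕ => (m : ℝ)) (lambertCount_mono_of_le hex hab)]
  refine Finset.sum_congr rfl fun m hm => ?_
  rw [Nat.cast_succ, add_sub_cancel_left]
  exact if_congr (lt_toReal_instant_succ_iff_of_lt_count ha hab hex (Finset.mem_range.1 hm)) rfl rfl

/-- **T4. Additivity of windowed jump sums over the window**: off the Zeno set at `b`, for `0 ≤ a ≤ c ≤ b` and
every summand `J`,
`Σ_{m<K_b} 1{a < t_{m+1}} J_m = Σ_{m<K_c} 1{a < t_{m+1}} J_m + Σ_{m<K_b} 1{c < t_{m+1}} J_m` (`J_m = J(t_{m+1}, z_m)`):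
split `range K_b = range K_c ∪ Ico K_c K_b` (`K_c ≤ K_b`, `Finset.sum_range_add_sum_Ico`); for `m < K_c`,
`t_{m+1} ≤ c` kills the indicator `1{c < t_{m+1}}`; for `K_c ≤ m < K_b`, `a ≤ c < t_{m+1}` and both indicators
are on (same bookkeeping as T3). [folklore] -/
theorem jumpSum_split : ∀ {d : Type*} [Fintype d] {X : Type*} {N : ℕ} {G : Geometry d X} {ε : ℝ}
    (J : ℝ × Config N d X → ℝ) {ξs : ℕ → EuclideanSpace ℝ d} {z : Config N d X} {a c b : ℝ},
    0 ≤ a → a ≤ c → c ≤ b → (∃ k, ENNReal.ofReal b < lambertInstant G ε ξs z k) →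
    (∑ m ∈ Finset.range (lambertCount G ε ξs z b),
        if a < (lambertInstant G ε ξs z (m + 1)).toReal then
          J ((lambertInstant G ε ξs z (m + 1)).toReal, lambertStateAfter G ε ξs z m) else 0) =
      (∑ m ∈ Finset.range (lambertCount G ε ξs z c),
        if a < (lambertInstant G ε ξs z (m + 1)).toReal then
          J ((lambertInstant G ε ξs z (m + 1)).toReal, lambertStateAfter G ε ξs z m) else 0) +
      ∑ m ∈ Finset.range (lambertCount G ε ξs z b),
        if c < (lambertInstant G ε ξs z (m + 1)).toReal then
          J ((lambertInstant G ε ξs z (m + 1)).toReal, lambertStateAfter G ε ξs z m) else 0 := by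
  intro d _ X N G ε J ξs z a c b ha hac hcb hex
  have hc : 0 ≤ c := ha.trans hac
  have hKcb : lambertCount G ε ξs z c ≤ lambertCount G ε ξs z b := lambertCount_mono_of_le hex hcb
  rw [← Finset.sum_range_add_sum_Ico _ hKcb, ← Finset.sum_range_add_sum_Ico _ hKcb]
  -- the `c`-window terms with `m < K_c` vanish
  have hvan : ∑ m ∈ Finset.range (lambertCount G ε ξs z c),
      (if c < (lambertInstant G ε ξs z (m + 1)).toReal then
        J ((lambertInstant G ε ξs z (m + 1)).toReal, lambertStateAfter G ε ξs z m) else 0) = 0 := by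
    refine Finset.sum_eq_zero fun m hm => if_neg ?_
    rw [lt_toReal_instant_succ_iff_of_lt_count hc hcb hex ((Finset.mem_range.1 hm).trans_le hKcb), not_le]
    exact Finset.mem_range.1 hm
  rw [hvan, zero_add, add_right_inj]
  -- on `K_c ≤ m < K_b` both indicators are on
  refine Finset.sum_congr rfl fun m hm => ?_
  rw [Finset.mem_Ico] at hm
  have hcm : c < (lambertInstant G ε ξs z (m + 1)).toReal :=
    (lt_toReal_instant_succ_iff_of_lt_count hc hcb hex hm.2).2 hm.1
  rw [if_pos hcm, if_pos (hac.trans_lt hcm)]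

end Pathwise

/-! ## T5. The two-level truncation error -/

/-- The truncation error at level `L` of a number of size at most `B`: `|y − max(−L)(min L y)| ≤ (B − L)₊`
(any sign of `L`). [folklore] -/
theorem abs_sub_trunc_le_posPart {y B L : ℝ} (hy : |y| ≤ B) : |y - max (-L) (min L y)| ≤ max (B - L) 0 := by
  have hyB : y ≤ B := (le_abs_self y).trans hy
  have hyB' : -y ≤ B := (neg_le_abs y).trans hy
  rcases le_total L y with hLy | hyL
  · rw [min_eq_left hLy]
    rcases le_total (-L) L with hL | hL
    · rw [max_eq_right hL, abs_of_nonneg (sub_nonneg.2 hLy)]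
      exact le_max_of_le_left (sub_le_sub_right hyB L)
    · rw [max_eq_left hL, sub_neg_eq_add]
      refine le_max_of_le_left (abs_le.2 ⟨by linarith, by linarith⟩)
  · rw [min_eq_right hyL]
    rcases le_total (-L) y with hL | hL
    · rw [max_eq_right hL, sub_self, abs_zero]
      exact le_max_right _ _
    · rw [max_eq_left hL, sub_neg_eq_add]
      refine le_max_of_le_left (abs_le.2 ⟨by linarith, by linarith⟩)

/-- A truncation at a level `ℓ ≥ 0` has size at most `ℓ`: `|max(−ℓ)(min ℓ x)| ≤ ℓ`. [folklore] -/
theorem abs_trunc_le_level {x ℓ : ℝ} (hℓ : 0 ≤ ℓ) : |max (-ℓ) (min ℓ x)| ≤ ℓ :=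
  abs_le.2 ⟨le_max_left _ _, max_le (by linarith) (min_le_left _ _)⟩

/-- **T5. The two-level truncation error of an indicator-weighted sum** (pure algebra): for `ℓ ≥ 0`, any `M`,
with `trunc_c y = max(−c)(min c y)`, `S = Σ_{m<K} 1{P m} x m`, `S_ℓ = Σ_{m<K} 1{P m} trunc_ℓ (x m)` and
`n = Σ_{m<K} 1{P m}`:  `|S − trunc_{ℓM} S_ℓ| ≤ Σ_{m<K} 1{P m} (|x m| − ℓ)₊ + (ℓ (n − M))₊`.
Triangle inequality through `S_ℓ`: `|S − S_ℓ| ≤ Σ 1{P} |x − trunc_ℓ x| ≤ Σ 1{P} (|x| − ℓ)₊`, and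
`|S_ℓ − trunc_{ℓM} S_ℓ| ≤ (ℓ n − ℓ M)₊` since `|S_ℓ| ≤ ℓ n` (`|trunc_ℓ| ≤ ℓ`). [folklore] -/
theorem abs_sub_trunc_sum_le : ∀ (K : ℕ) (P : ℕ → Prop) [DecidablePred P] (x : ℕ → ℝ) {ℓ : ℝ}, 0 ≤ ℓ → ∀ M : ℝ,
    |(∑ m ∈ Finset.range K, if P m then x m else 0) -
        max (-(ℓ * M)) (min (ℓ * M) (∑ m ∈ Finset.range K, if P m then max (-ℓ) (min ℓ (x m)) else 0))| ≤
      (∑ m ∈ Finset.range K, if P m then max (|x m| - ℓ) 0 else 0) +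
        max (ℓ * ((∑ m ∈ Finset.range K, if P m then (1 : ℝ) else 0) - M)) 0 := by
  intro K P _ x ℓ hℓ M
  -- `|S_ℓ| ≤ ℓ n`
  have hSl : |∑ m ∈ Finset.range K, (if P m then max (-ℓ) (min ℓ (x m)) else 0)| ≤
      ℓ * ∑ m ∈ Finset.range K, (if P m then (1 : ℝ) else 0) := by
    rw [Finset.mul_sum]
    refine (Finset.abs_sum_le_sum_abs _ _).trans (Finset.sum_le_sum fun m _ => ?_)
    split_ifs
    · rw [mul_one]; exact abs_trunc_le_level hℓ
    · rw [abs_zero, mul_zero]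
  -- `|S − S_ℓ| ≤ Σ 1{P} (|x| − ℓ)₊`
  have hS : |(∑ m ∈ Finset.range K, if P m then x m else 0) -
      ∑ m ∈ Finset.range K, (if P m then max (-ℓ) (min ℓ (x m)) else 0)| ≤
      ∑ m ∈ Finset.range K, (if P m then max (|x m| - ℓ) 0 else 0) := by
    rw [← Finset.sum_sub_distrib]
    refine (Finset.abs_sum_le_sum_abs _ _).trans (Finset.sum_le_sum fun m _ => ?_)
    split_ifs
    · exact abs_sub_trunc_le_posPart le_rfl
    · rw [sub_zero, abs_zero]
  -- `|S_ℓ − trunc_{ℓM} S_ℓ| ≤ (ℓ n − ℓ M)₊`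
  have hT := abs_sub_trunc_le_posPart (L := ℓ * M) hSl
  rw [← mul_sub] at hT
  exact (abs_sub_le _ _ _).trans (add_le_add hS hT)

end Summit.AtomisticToContinuum.HydrodynamicLimit.Theorems.LambertianContactSwapLambertianEulerJumpSumTools

end
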